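import Summits.MatrixMultiplication.MatrixMultiplication.Theses.LevelGradedCohnUmans
import Summits.MatrixMultiplication.MatrixMultiplication.Theorems.LieRankDesigns.Negative.Basics

/-!
# Negative lemmas for the crux `LevelOneGL2Designs` (stmt-MatrixMultiplication-14080), part B:
kill transfer to the exponent-3 cell and the packing-bound kill criterion

Refuter-side (cdisprove) analysis of `LevelGradedCohnUmans.LevelOneGL2Designs`; pure `ε`/`rpow`
bookkeeping over the crux as filed (vocabulary `GLm`, `RankSep` of `LieRankDesigns.Negative.Basics`,
to which the crux unfolds by `Iff.rfl`).  No theorem asserts a Theses statement positively.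

* `beatsCubes_of_levelOneGL2Designs` — KILL TRANSFER: the crux implies that for unboundedly many
  primes `p` some rank-1-separated triple of `GL_2(𝔽_p)` beats the level-one sum of cubes
  `B₃(p) = 1 + p³ + (p−2)(p+1)³` (the `(m,k) = (2,1)` cell of the route item `LieRankBeatsCubes`,
  stmt-14057, with its budget in closed form): `V ≥ c³p^{9/2} > 10p⁴ ≥ B₃(p)` once `√p > 10/c³`.
* `not_levelOneGL2Designs_of_eventually_not_beatsCubes` — contrapositive: if that cell is EMPTY for
  all large `p` (it is empty for `p ≤ 7` by the graded Neumann count), the crux is false.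
* `not_levelOneGL2Designs_of_packingBound` — KILL CRITERION: any level-one packing bound
  `|X||Y||Z| ≤ C·p⁴` for rank-1-separated triples refutes the crux (`c³p^{9/2} ≤ Cp⁴` fails once
  `c⁶p > C²`).  Such a bound ("graded mixing", `V ≲ W^{3/2}/√d_min`) is the named open kill.
-/

noncomputable section

namespace Summit.MatrixMultiplication.MatrixMultiplication.Theorems.LevelOneGL2Designs.Negative

open Summit.MatrixMultiplication.MatrixMultiplication.Theses.LevelGradedCohnUmans
open Summit.MatrixMultiplication.MatrixMultiplication.Theorems.LieRankDesigns.Negative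

/-- Crude bound on the level-one sum of cubes: `B₃(p) = 1 + p³ + (p−2)(p+1)³ ≤ 10 p⁴`. [folklore] -/
theorem budget3_le (p : ℕ) (hp : 1 ≤ p) : 1 + p ^ 3 + (p - 2) * (p + 1) ^ 3 ≤ 10 * p ^ 4 := by
  have h1 : (p - 2) * (p + 1) ^ 3 ≤ p * (2 * p) ^ 3 := by
    have ha : p - 2 ≤ p := Nat.sub_le _ _
    have hb : (p + 1) ^ 3 ≤ (2 * p) ^ 3 := Nat.pow_le_pow_left (by omega) 3
    exact Nat.mul_le_mul ha hb
  have h2 : p * (2 * p) ^ 3 = 8 * p ^ 4 := by ring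
  have h3 : 1 ≤ p ^ 4 := Nat.one_le_pow _ _ hp
  have h4 : p ^ 3 ≤ p ^ 4 := Nat.pow_le_pow_right hp (by norm_num)
  omega

/-- The cube `(c p^{3/2})³` of the size bound, computed: `= c³ · p³ · p^{3/2} ≥ c³ p⁴`, and it sits
below the volume. -/
theorem volume_lower {p : ℕ} [Fact p.Prime] {c : ℝ} (hc : 0 < c) {X Y Z : Finset (GLm p 2)}
    (hX : c * (p : ℝ) ^ (3 / 2 : ℝ) ≤ X.card) (hY : c * (p : ℝ) ^ (3 / 2 : ℝ) ≤ Y.card)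
    (hZ : c * (p : ℝ) ^ (3 / 2 : ℝ) ≤ Z.card) :
    c ^ 3 * (p : ℝ) ^ 4 ≤ ((X.card * Y.card * Z.card : ℕ) : ℝ) ∧
      (c ^ 3 * (p : ℝ) ^ 4) * (c ^ 3 * (p : ℝ) ^ 4) * p
        ≤ ((X.card * Y.card * Z.card : ℕ) : ℝ) * ((X.card * Y.card * Z.card : ℕ) : ℝ) := by
  have hp0 : (0 : ℝ) < p := by exact_mod_cast (Fact.out : p.Prime).pos
  have hp1 : (1 : ℝ) ≤ p := by exact_mod_cast (Fact.out : p.Prime).one_lt.le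
  set L : ℝ := c * (p : ℝ) ^ (3 / 2 : ℝ) with hL
  have hL0 : 0 < L := by positivity
  have hV : L * L * L ≤ ((X.card * Y.card * Z.card : ℕ) : ℝ) := by
    push_cast
    have hXY : L * L ≤ (X.card : ℝ) * Y.card := mul_le_mul hX hY hL0.le (le_trans hL0.le hX)
    exact mul_le_mul hXY hZ hL0.le (le_trans (by positivity) hXY)
  have h33 : (p : ℝ) ^ (3 / 2 : ℝ) * (p : ℝ) ^ (3 / 2 : ℝ) = (p : ℝ) ^ 3 := by
    rw [← Real.rpow_add hp0, show (3 / 2 : ℝ) + 3 / 2 = ((3 : ℕ) : ℝ) by norm_num,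
      Real.rpow_natCast]
  have h32 : (p : ℝ) ≤ (p : ℝ) ^ (3 / 2 : ℝ) := by
    conv_lhs => rw [← Real.rpow_one (p : ℝ)]
    exact Real.rpow_le_rpow_of_exponent_le hp1 (by norm_num)
  have hLL : L * L = c ^ 2 * (p : ℝ) ^ 3 := by
    rw [hL]
    calc c * (p : ℝ) ^ (3 / 2 : ℝ) * (c * (p : ℝ) ^ (3 / 2 : ℝ))
        = c ^ 2 * ((p : ℝ) ^ (3 / 2 : ℝ) * (p : ℝ) ^ (3 / 2 : ℝ)) := by ring
      _ = c ^ 2 * (p : ℝ) ^ 3 := by rw [h33]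
  have hLLL : c ^ 3 * (p : ℝ) ^ 4 ≤ L * L * L := by
    have hc3 : 0 ≤ c ^ 2 * (p : ℝ) ^ 3 * c := by positivity
    calc c ^ 3 * (p : ℝ) ^ 4 = c ^ 2 * (p : ℝ) ^ 3 * c * p := by ring
      _ ≤ c ^ 2 * (p : ℝ) ^ 3 * c * (p : ℝ) ^ (3 / 2 : ℝ) := mul_le_mul_of_nonneg_left h32 hc3
      _ = L * L * L := by rw [hLL, hL]; ring
  have h6 : (L * L * L) * (L * L * L) = c ^ 6 * (p : ℝ) ^ 9 := by
    calc (L * L * L) * (L * L * L) = (L * L) * (L * L) * (L * L) := by ring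
      _ = c ^ 6 * (p : ℝ) ^ 9 := by rw [hLL]; ring
  refine ⟨hLLL.trans hV, ?_⟩
  calc (c ^ 3 * (p : ℝ) ^ 4) * (c ^ 3 * (p : ℝ) ^ 4) * p = c ^ 6 * (p : ℝ) ^ 9 := by ring
    _ = (L * L * L) * (L * L * L) := h6.symm
    _ ≤ _ := mul_le_mul hV hV (by positivity) (by positivity)

/-- **Kill transfer.**  `LevelOneGL2Designs` implies the exponent-3 milestone of the `(2,1)` cell
for unboundedly many primes: some rank-1-separated triple of `GL_2(𝔽_p)` has
`|X||Y||Z| > 1 + p³ + (p−2)(p+1)³`. -/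
theorem beatsCubes_of_levelOneGL2Designs (h : LevelOneGL2Designs) :
    ∀ p₀ : ℕ, ∃ (p : ℕ) (_ : Fact p.Prime), p₀ ≤ p ∧
      ∃ X Y Z : Finset (GLm p 2), RankSep 1 X Y Z ∧
        1 + p ^ 3 + (p - 2) * (p + 1) ^ 3 < X.card * Y.card * Z.card := by
  obtain ⟨c, hc, hall⟩ := h
  intro p₀
  obtain ⟨N, hN⟩ := exists_nat_gt (max (p₀ : ℝ) (100 / c ^ 6 + 1))
  obtain ⟨p, hprime, hNp, X, Y, Z, hsep, hX, hY, hZ⟩ := hall N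
  have hp0 : (0 : ℝ) < p := by exact_mod_cast hprime.out.pos
  have hNR : (N : ℝ) ≤ p := by exact_mod_cast hNp
  have hp₀ : p₀ ≤ p := by
    have : (p₀ : ℝ) ≤ p := le_trans (le_trans (le_max_left _ _) hN.le) hNR
    exact_mod_cast this
  refine ⟨p, hprime, hp₀, X, Y, Z, hsep, ?_⟩
  have hthr : 100 / c ^ 6 < p := by
    have := lt_of_lt_of_le (lt_of_le_of_lt (le_max_right _ _) hN) hNR
    linarith
  obtain ⟨-, hsq⟩ := volume_lower hc hX hY hZ
  set V : ℝ := ((X.card * Y.card * Z.card : ℕ) : ℝ) with hVdef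
  have hB : ((1 + p ^ 3 + (p - 2) * (p + 1) ^ 3 : ℕ) : ℝ) ≤ 10 * (p : ℝ) ^ 4 := by
    exact_mod_cast budget3_le p hprime.out.one_lt.le
  -- (10 p⁴)² < (c³p⁴)²·p ≤ V²
  have hc6 : 0 < c ^ 6 := by positivity
  have h100 : 100 < c ^ 6 * p := by
    have := (div_lt_iff₀ hc6).mp hthr
    linarith
  have hlt2 : (10 * (p : ℝ) ^ 4) * (10 * (p : ℝ) ^ 4) < V * V := by
    have hp8 : 0 < (p : ℝ) ^ 8 := by positivity
    have : (10 * (p : ℝ) ^ 4) * (10 * (p : ℝ) ^ 4) < (c ^ 3 * (p : ℝ) ^ 4) * (c ^ 3 * (p : ℝ) ^ 4) * p := by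
      nlinarith
    exact this.trans_le hsq
  have hlt : 10 * (p : ℝ) ^ 4 < V := by
    by_contra hge
    push Not at hge
    have hV0 : 0 ≤ V := by rw [hVdef]; positivity
    nlinarith [mul_le_mul hge hge hV0 (by positivity)]
  have hfin : ((1 + p ^ 3 + (p - 2) * (p + 1) ^ 3 : ℕ) : ℝ) < V := lt_of_le_of_lt hB hlt
  rw [hVdef] at hfin
  exact_mod_cast hfin

/-- **Contrapositive — the usable kill criterion for the `LieRankBeatsCubes` seat.**  If no
rank-1-separated triple of `GL_2(𝔽_p)` beats the level-one sum of cubes for any prime beyond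
some `p₀`, then `LevelOneGL2Designs` is false. -/
theorem not_levelOneGL2Designs_of_eventually_not_beatsCubes
    (h : ∃ p₀ : ℕ, ∀ (p : ℕ) [Fact p.Prime], p₀ ≤ p → ∀ X Y Z : Finset (GLm p 2),
      RankSep 1 X Y Z → X.card * Y.card * Z.card ≤ 1 + p ^ 3 + (p - 2) * (p + 1) ^ 3) :
    ¬ LevelOneGL2Designs := by
  intro hX
  obtain ⟨p₀, hp₀⟩ := h
  obtain ⟨p, hprime, hle, X, Y, Z, hsep, hlt⟩ := beatsCubes_of_levelOneGL2Designs hX p₀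
  exact absurd (hp₀ p hle X Y Z hsep) (not_le.mpr hlt)

/-- **Packing bound ⇒ ¬ crux.**  If every rank-1-separated triple of `GL_2(𝔽_p)` has
`|X||Y||Z| ≤ C·p⁴` (all primes `p`), then `LevelOneGL2Designs` is false: `c³p^{9/2} ≤ V ≤ Cp⁴`
fails as soon as `c⁶p > C²`. -/
theorem not_levelOneGL2Designs_of_packingBound {C : ℝ}
    (hC : ∀ (p : ℕ) [Fact p.Prime] (X Y Z : Finset (GLm p 2)), RankSep 1 X Y Z →
      ((X.card * Y.card * Z.card : ℕ) : ℝ) ≤ C * (p : ℝ) ^ 4) :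
    ¬ LevelOneGL2Designs := by
  rintro ⟨c, hc, hall⟩
  obtain ⟨N, hN⟩ := exists_nat_gt (C ^ 2 / c ^ 6 + 1)
  obtain ⟨p, hprime, hNp, X, Y, Z, hsep, hX, hY, hZ⟩ := hall N
  have hp0 : (0 : ℝ) < p := by exact_mod_cast hprime.out.pos
  have hNR : (N : ℝ) ≤ p := by exact_mod_cast hNp
  have hthr : C ^ 2 / c ^ 6 < p := by linarith
  obtain ⟨hlow, hsq⟩ := volume_lower hc hX hY hZ
  have hup := hC p X Y Z hsep
  set V : ℝ := ((X.card * Y.card * Z.card : ℕ) : ℝ)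
  have hC0 : 0 < C := by
    have : 0 < C * (p : ℝ) ^ 4 := lt_of_lt_of_le (by positivity) (hlow.trans hup)
    have hp4 : 0 < (p : ℝ) ^ 4 := by positivity
    nlinarith
  have hVV : V * V ≤ (C * (p : ℝ) ^ 4) * (C * (p : ℝ) ^ 4) :=
    mul_le_mul hup hup (by positivity) (by positivity)
  have hc6 : 0 < c ^ 6 := by positivity
  have hthr' : C ^ 2 < c ^ 6 * p := by
    have := (div_lt_iff₀ hc6).mp hthr
    linarith
  have hp8 : 0 < (p : ℝ) ^ 8 := by positivity
  have key : (c ^ 3 * (p : ℝ) ^ 4) * (c ^ 3 * (p : ℝ) ^ 4) * p ≤ (C * (p : ℝ) ^ 4) * (C * (p : ℝ) ^ 4) :=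
    hsq.trans hVV
  nlinarith [mul_lt_mul_of_pos_right hthr' hp8]

end Summit.MatrixMultiplication.MatrixMultiplication.Theorems.LevelOneGL2Designs.Negative

end
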